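import Summits.QuantumFields.YangMills.Theorems.AlphaInputsT3ACBridge
import Literature.MathematicalPhysics.QuantumFieldTheory.Balaban1983to89.T3PrintedMinimiserExistence
import HarnessLib

/-!
# `AlphaInputsT3ACv2` — the (α) socket READ AT THE T³ OBJECTS, VERSION 2: `AlphaInputsT3AC.Of` STRENGTHENED BY THE MINIMISER ROWS r1–r3 and the
# TERMINAL data-regularity rows, under NEW NAMES (`AlphaInputsT3AC.OfV2`, `AlphaInputsT3ACv2 L`) with projections to v1 — route owner RULING
# g16-№2 (pub/ym3-torus STATUS 2026-08-26T21:35:42Z, finding F-owner-g16-1) in the tree's deprecate-and-add form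

Lane `pub-balaban3d`, seat alpha-1 (PEN named by the ruling; interface desk lit-balaban typer g41, DESK NOTE 2026-08-26T22:00:37Z / PEN ANSWER
23:19:50Z).  WHY.  v1's `AlphaInputsT3AC.Of F 𝔠` (this directory, p453618) ∃-quantifies the minimiser data `reg, U_k, U_k(·,h)` with only
`hU0`/`hUs` + `AlphaAC.RunAlphaAC`, whose rows carry NO variational identification of `U_k(·,h)`; the α-adapter stubs of route `UnitScaleTilt`
(19201 `stub_alphaTwoRunOfLane`, 18916 `stub_alphaOfLaneFull`) take `Of` as their only (α) hypothesis yet must PRODUCE the interface's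
`UminTrivIsRegMinimiser`/`Constraint42Top`/`Regularity68` — load mis-placed (they silently re-contain [Balaban1985Variational] Thm 1).  The ruling
asked for an IN-PLACE erratum of `Of`; the gate's decl-level append-only rule for `Summits/…/Theorems` refuses body changes («deprecate, don't
mutate»), so v2 lands HERE under new names, v1 untouched (and thereby DEPRECATED for the adapters: cite `AlphaInputsT3ACv2 L` instead; every v1
consequence is inherited through `OfV2.toOf` / `AlphaInputsT3ACv2.toV1`).  The in-place drafts are parked for an operator maintenance write at
`pub/pub-balaban3d/erratum-v2-inplace-drafts/` should the owner prefer that form.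

CONTENTS (hypothesis schemas and bookkeeping; nothing of [Balaban1985UV3]/[Balaban1985Variational] is asserted):
* §1 `ChargedT3` — print's (40) support at the top level (admissible history, datum plaquettes in `Ω_k(h)` below the `χ_k` cut-off
  `2L²g_{k−1}p(g_{k−1})`); `MinimiserRowsT3 F 𝔠 γ hγ hγ1 a₀ a₁ K UkH` — (r1) [Balaban1985Variational] Thm 1 + Prop 7 read on `U_k(·, triv)` in the
  tree's GLOBAL form (`T3PrintedMinimiserExistence.Thm1GlobalMinAt` shape; constants `a₀, a₁` at the record's level, `B₃ := 𝔠.B₃`; heights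
  `n < K` — at `n = K` there is no minimiser, (1) p.256, seat finding F-α1-6), (r2) (42)/(67) at the top level in torus-iterate form (the
  interface's `Constraint42Top` body), (r3) (68) in the multi-level T³ form (`Regularity68Levels` body; `s = 0` = `Regularity68`), r2/r3 on
  `ChargedT3`; `TerminalRowsT3` — `U_K(·,h)` measurable, `Pint_K` measurable and bounded above (the `hU`/`hPm`/`hPb` shape of `StepAlphaAC`
  at the terminal level, which `RunAlphaAC.steps` (`k + 1 ≤ K`) does not reach; seat finding F-α1-4).
* §2 `AlphaInputsT3AC.OfV2 F 𝔠` := `∃ a₀ a₁ (consts), ∀ γ hγ hγ1 K, ∃ (v1 data), RunAlphaAC ∧ MinimiserRowsT3 ∧ TerminalRowsT3`;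
  `AlphaInputsT3ACv2 L := ∃ 𝔠, ∀ F hF, OfV2 F (hF ▸ 𝔠)`; `AtScaleT3ACv2`; `OfV2.toOf`, `AlphaInputsT3ACv2.toV1`, `alphaInputsT3ACv2_iff`,
  `AlphaInputsT3ACv2.of_family`.
* §3 `AlphaInputsT3AC.PkgAtV2` (extends `PkgAt` by `a₀ a₁ consts_ok minRows termRows`), `OfV2.a₀/a₁/consts_spec`, `OfV2.pkgAtV2` (classical
  choice THROUGH a subtype so that `(h.pkgAtV2 γ hγ hγ1 K).a₀ = h.a₀`: the [7] constants are uniform in `γ`, `K` — `pkgAtV2_a₀/a₁`).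
* §4 the rows projected: `PkgAtV2.constraint42`, `.regularity68Levels`, `.uminTriv_mem_regFibrePr` / `.uminTriv_action_eq` (r1 ⇒ the two clauses
  of the interface's `UminTrivIsRegMinimiser` at radius `ε₀` under `θ ≤ a₁`, `B₃θ ≤ ε₀ ≤ a₀`, via `regFibrePr_mono` + `minActionRegPr_eq_of_isMinOn`),
  `.terminal_measurable_UkH/_measurable_Pint/_Pint_le`.
The datum built from `pkgAtV2` with `Adm := ChargedT3` and its delivered schemas are `AlphaInputsT3ACv2Data` (next file).

References: T. Bałaban, Commun. Math. Phys. 102 (1985) 255–275 [Balaban1985UV3] ((1) p.256, (40)–(42) p.266, (47) p.267, (67)–(68) p.273, Thm 2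
p.272); Commun. Math. Phys. 102 (1985) 277–309 [Balaban1985Variational] ((6)–(8) and Thm 1 p.278–279, Prop 7 p.299).
-/

set_option autoImplicit false

noncomputable section

namespace Summit.QuantumFields.YangMills.Theorems

open MeasureTheory
open Literature.MathematicalPhysics.QuantumFieldTheory.Balaban1983to89
open Literature.MathematicalPhysics.QuantumFieldTheory.Balaban1983to89.T3ContinuumYM3Torus
open Literature.MathematicalPhysics.QuantumFieldTheory.Balaban1983to89.T3UnitLawDensityEML (ℰp)
open Literature.MathematicalPhysics.QuantumFieldTheory.Balaban1983to89.T3UnitScaleTilt (θBal)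
open Literature.MathematicalPhysics.QuantumFieldTheory.Balaban1983to89.T3LevelShift (fieldShift)
open Literature.MathematicalPhysics.QuantumFieldTheory.Balaban1983to89.T3PrintedRegularMinimiser (regFibrePr minActionRegPr)
open Literature.MathematicalPhysics.QuantumFieldTheory.Balaban1983to89.T3PrintedMinimiserExistence (regFibrePr_mono minActionRegPr_eq_of_isMinOn)
open Literature.MathematicalPhysics.QuantumFieldTheory.Balaban1983to89.B10Eq38TorusDomains (plaqsIn)
open Literature.MathematicalPhysics.QuantumFieldTheory.Balaban1983to89.B10Eq42TorusConstraint (bondsIn lam42)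
open Literature.MathematicalPhysics.QuantumFieldTheory.Balaban1985CMP102
open Literature.MathematicalPhysics.QuantumFieldTheory.Balaban1985CMP102.Setting
open Summit.QuantumFields.Balaban3D.Carriers
open Summit.QuantumFields.Balaban3D.Proofs.Primitives
open Summit.QuantumFields.Balaban3D.Proofs.GroupModelLieC (lieC)
open Summit.QuantumFields.Balaban3D.Proofs.TowerAC
open Summit.QuantumFields.Balaban3D.Proofs.StandardAC
open Summit.QuantumFields.Balaban3D.Proofs.InputsAC
open Summit.QuantumFields.Balaban3D.Proofs.AlphaAC

/-! ## §1 Print's (40) support, the minimiser rows r1–r3, the terminal data-regularity rows -/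

/-- **PRINT'S SUPPORT OF THE CHARACTERISTIC FUNCTIONS OF (41) AT THE TOP LEVEL** for the lane's discrete histories (fields integrated out,
reading D-41): the history `h` is ADMISSIBLE (`Carriers.Hist.Admissible`: each passage's large-field plaquettes inside the current region) and the
level-`k` datum `W` has every plaquette inside `Ω_k(h)` below the `χ_k` cut-off `2L²·B·g_{k−1}p(g_{k−1})` (route units: `2L²·B·θBal(K − k + 1)`;
`B = 1` is the lane's `Carriers.epsSOf`, print's is `B₃`, the package below takes `B := avgWindowFactor L`) — [Balaban1985UV3] (40) p.266 «χ_j = Π_{p⊂Λ_j} χ({|V_j(∂p) − 1| < 2L²g_{j−1}p(g_{j−1})}), j = 1, …, k, where we have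
denoted V_k = V» (at the trivial history `Ω_k = T_η`: every plaquette of `W`).  The guard of the minimiser rows r2/r3 below (the window on which
(42)–(46), (67)–(68) are derived, p.267 l.1–3). [cite: Balaban1985UV3, (40) p.266] -/
def ChargedT3 (F : T3Family) (γ b₀ p₀ B : ℝ) (K : ℕ) (M₁ : ℕ) (Rcol : ℕ → ℕ) (k : ℕ) (h : Hist (F.P K) k)
    (W : GaugeField (F.P K) k (Matrix.specialUnitaryGroup (Fin 2) ℂ)) : Prop :=
  Hist.Admissible M₁ Rcol k h ∧
    PlaqSmallOn (↑(plaqsIn k (Omega M₁ Rcol k h k))) (2 * (F.L : ℝ) ^ 2 * B * θBal F.L γ b₀ p₀ (K - k + 1)) W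

/-- **THE WINDOW FACTOR OF THE LANE'S (0.4)-AVERAGING**: `L² + 6(5L)²` (= `151L²`) — the constant of the tree's crude form of
[Balaban1985Averaging] Prop. 1 for `blockAvg ℰp` at `d = 3` (`BlockAveragingPlaquetteBound.plaqSmall_blockAvg_expMeanLogSU`: `PlaqSmall a U ⇒
PlaqSmall ((L² + 6((d+2)L)²)·a) (Ū)`).  Used as the `B` of `ChargedT3` in the package: with it the (40)-window at level `k` CONTAINS the block
averages of the `χ_k`-small level-`(k−1)` fields (`2L²·151L²·θBal(K−k+1) ≥ 151L²·εS(k−1)` once `θ` is antitone), so that a trivial mass WINDOWED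
at `ChargedT3` (owner ruling g17 (A) «window the floor») keeps the transport inequality `T_k[w·m] ≤ m_{k+1}` almost everywhere; print's own
factor is `B₃` with the sharp averaging constant `L²(1 + O(ε))` ((40) p.266, p.267 l.1–3). [cite: Balaban1985Averaging, Prop. 1 (51) p.26] -/
def avgWindowFactor (L : ℕ) : ℝ := (L : ℝ) ^ 2 + 6 * (((3 + 2) * L : ℕ) : ℝ) ^ 2

section Rows

variable (F : T3Family) (𝔠 : AlphaConsts F.L (suGroupModel 2).N) (γ : ℝ) (hγ : 0 < γ) (hγ1 : γ ≤ (min 𝔠.gamma0 1) ^ 2)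

/-- **THE MINIMISER ROWS r1–r3 OF THE PACKAGE'S COMPOSITE MINIMISERS `U_k(·, h)` AT RUN `K`** (hypothesis schema, never asserted):
(r1) [Balaban1985Variational] THM 1 + PROP 7 READ ON `U_k(·, triv)`, global reading (`T3PrintedMinimiserExistence.Thm1GlobalMinAt` shape): for
`n < K` (`k = K − n ≥ 1` averaging steps), `0 < ε₁ ≤ a₁`, `B₃ε₁ ≤ ε₀ ≤ a₀` and every datum `V` of the `n`-th approximation with `|V(∂p) − 1| < ε₁`
((7) p.278), the trivial-history minimiser `U_{K−n}(triv, V)` (read on run `K`'s tower, `fieldShift`) lies in the space (8) = `regFibrePr F n K _ (B₃ε₁) V`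
and MINIMISES the Wilson action over the space (6) = `regFibrePr F n K _ ε₀ V` — Thm 1 p.279 «there exists a minimal orbit in the space
𝔘_k({Ω_j}, B₃ε₁) ∩ 𝔅_k(V) (8). This orbit is a unique critical orbit in the space (6) if B₃ε₁ ≤ ε₀ and ε₀ ≤ a₀»; (r2) (42) p.266 / (67) p.273
«Ū_k^j = V_j on Λ_j» AT THE TOP LEVEL in torus-iterate form — for every charged pair `(h, W)` (`ChargedT3`) the `k`-fold `blockAvg ℰp`-average of
`U_k(h, W)` equals `W` on the bonds of `T^{(k)}` inside `Ω_k(h)` (the interface's `Constraint42Top` body); (r3) (68) p.273 «the configuration U_k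
satisfies the following regularity condition on B_j(Λ_j): |U_k(∂p) − 1| < O(1)g_jp(g_j)L^{−2j}» in the multi-level T³ form (the interface's
`Regularity68Levels` body; `s = 0` is (68) itself): for charged `(h, W)`, `i ≤ k`, `s ≤ i`, every level-`s` plaquette under `Λ_i(h)` of the `s`-fold
average of `U_k(h, W)` is within `C68·θBal(K − i)·L^{−2(i−s)}` of `1`.  Regions `Ω` = `Carriers.Omega` at the record's `M₁` and collar `rcolOf`,
as the AC tower reads them. [cite: Balaban1985Variational, Thm 1 (8) p.279; Balaban1985UV3, (42) p.266 and (67)-(68) p.273] -/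
def MinimiserRowsT3 (a₀ a₁ : ℝ) (K : ℕ)
    (UkH : (k : ℕ) → Hist (F.P K) k → GaugeField (F.P K) k (Matrix.specialUnitaryGroup (Fin 2) ℂ) →
      GaugeField (F.P K) 0 (Matrix.specialUnitaryGroup (Fin 2) ℂ)) : Prop :=
  (∀ (n : ℕ) (hnK : n < K) (ε₁ ε₀ : ℝ), 0 < ε₁ → ε₁ ≤ a₁ → 𝔠.B₃ * ε₁ ≤ ε₀ → ε₀ ≤ a₀ →
    ∀ V : GaugeField (F.P n) 0 (Matrix.specialUnitaryGroup (Fin 2) ℂ), PlaqSmall ε₁ V →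
      UkH (K - n) (Hist.triv (F.P K) (K - n))
          (fieldShift (F.sitesPerDir_eq (m := F.m) (K := K) (j := K - n) (m' := F.m) (K' := n) (j' := 0) (by omega)) V) ∈
        regFibrePr F n K hnK.le (𝔠.B₃ * ε₁) V ∧
      IsMinOn (fun U : GaugeField (F.P K) 0 (Matrix.specialUnitaryGroup (Fin 2) ℂ) => wilsonAction4 U)
        (regFibrePr F n K hnK.le ε₀ V)
        (UkH (K - n) (Hist.triv (F.P K) (K - n))
          (fieldShift (F.sitesPerDir_eq (m := F.m) (K := K) (j := K - n) (m' := F.m) (K' := n) (j' := 0) (by omega)) V))) ∧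
  (∀ (k : ℕ), k ≤ K → ∀ (h : Hist (F.P K) k) (W : GaugeField (F.P K) k (Matrix.specialUnitaryGroup (Fin 2) ℂ)),
    ChargedT3 F γ 𝔠.b₀ 𝔠.p₀ (avgWindowFactor F.L) K 𝔠.lane.carrier.M₁
        (rcolOf (T3Scales F γ hγ (hγ1.trans (sq_min_one_le _ 𝔠.gamma0_pos)) K) 𝔠.lane.carrier) k h W →
      ∀ b : PBond (F.P K) k,
        b ∈ bondsIn k (Omega 𝔠.lane.carrier.M₁
          (rcolOf (T3Scales F γ hγ (hγ1.trans (sq_min_one_le _ 𝔠.gamma0_pos)) K) 𝔠.lane.carrier) k h k) →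
        Averaging.iter (fun i => BlockAveraging.blockAvg (P := F.P K) (j := i) ℰp) k (UkH k h W) b = W b) ∧
  (∀ (k : ℕ), k ≤ K → ∀ (h : Hist (F.P K) k) (W : GaugeField (F.P K) k (Matrix.specialUnitaryGroup (Fin 2) ℂ)),
    ChargedT3 F γ 𝔠.b₀ 𝔠.p₀ (avgWindowFactor F.L) K 𝔠.lane.carrier.M₁
        (rcolOf (T3Scales F γ hγ (hγ1.trans (sq_min_one_le _ 𝔠.gamma0_pos)) K) 𝔠.lane.carrier) k h W →
      ∀ i, i ≤ k → ∀ s, s ≤ i → ∀ q : Plaq (F.P K) s,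
        q ∈ plaqsIn s (lam42 (Omega 𝔠.lane.carrier.M₁
          (rcolOf (T3Scales F γ hγ (hγ1.trans (sq_min_one_le _ 𝔠.gamma0_pos)) K) 𝔠.lane.carrier) k h) k i) →
        GaugeGroup.dist1 (GaugeField.plaqHol
            (Averaging.iter (fun l => BlockAveraging.blockAvg (P := F.P K) (j := l) ℰp) s (UkH k h W)) q) ≤
          𝔠.C68 * θBal F.L γ 𝔠.b₀ 𝔠.p₀ (K - i) * (((F.L : ℝ) ^ (i - s))⁻¹) ^ 2)

variable (K : ℕ)

/-- **THE DATA-REGULARITY ROWS AT THE TERMINAL LEVEL `k = K`** (hypothesis schema, never asserted; seat finding F-α1-4): the composite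
minimiser maps `U_K(·, h)` are measurable, and the interaction sum `Pint_K(h, ·)` of (43) (DEFINED from the expansion data) is measurable and
bounded above by `cP` — the shape of `AlphaAC.StepAlphaAC`'s rows `hU`/`hPm`/`hPb`, which `RunAlphaAC.steps` supplies only for `k + 1 ≤ K`; the
package's envelope clause (`T3AlphaInputsAC.EnvelopeRegular`) also reads the top level `j = K` ([Balaban1985UV3] §B p.265 «inequalities satisfied
by all the actions ρ_k, k = 1, 2, …, K»). [cite: Balaban1985UV3, (41) p.266 and Sect. B p.265] -/
def TerminalRowsT3
    (X : ExternalInputsAC (T3Scales F γ hγ (hγ1.trans (sq_min_one_le _ 𝔠.gamma0_pos)) K) (Matrix.specialUnitaryGroup (Fin 2) ℂ))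
    (𝔖 : ∀ k, StepSeries (T3Scales F γ hγ (hγ1.trans (sq_min_one_le _ 𝔠.gamma0_pos)) K) (Matrix.specialUnitaryGroup (Fin 2) ℂ)
      ↥(lieC (suGroupModel 2)) (nblkOf (T3Scales F γ hγ (hγ1.trans (sq_min_one_le _ 𝔠.gamma0_pos)) K) 𝔠.lane.carrier k) k)
    (cP : ℝ) : Prop :=
  (∀ h : Hist (F.P K) K, Measurable (X.UkH K h)) ∧
    (∀ h : Hist (F.P K) K, Measurable ((inputOfAC 𝔠.lane X 𝔖).Pint K h)) ∧
      ∀ (h : Hist (F.P K) K) (U : GaugeField (F.P K) K (Matrix.specialUnitaryGroup (Fin 2) ℂ)), (inputOfAC 𝔠.lane X 𝔖).Pint K h U ≤ cP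

end Rows

/-! ## §2 The strengthened package under new names, and its projections to v1 -/

/-- **(α) AT THE T³ OBJECTS, ONE FAMILY — VERSION 2** (hypothesis schema, never asserted): there are constants `a₀, a₁ > 0` with `B₃a₁ ≤ a₀` of
[Balaban1985Variational] Thm 1 («depend on d and L only»; `B₃ := 𝔠.B₃`) such that for every coupling `γ ∈ (0, (min 𝔠.γ₀ 1)²]` and every `K` there
are minimizer data (`reg`, `U_k`, `U_k(·,h)`), expansion data `𝔖` and auxiliary data `𝔄` with (i) the AC (α) rows `AlphaAC.RunAlphaAC` for the
pinned inputs `XT3` — EXACTLY v1's `AlphaInputsT3AC.Of` body; (ii) the MINIMISER ROWS `MinimiserRowsT3` (r1 [7] Thm 1 + Prop 7 on `U_k(·, triv)`,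
r2 (42)/(67) top, r3 (68) multi-level, on print's (40) support); (iii) the TERMINAL data-regularity rows `TerminalRowsT3` at `k = K`.
[cite: Balaban1985UV3, Thm 1 p.257 + Thm 2 p.272 + (41)-(42) p.266 + (47) p.267 + (67)-(68) p.273; Balaban1985Variational, Thm 1 (8) p.279] -/
def AlphaInputsT3AC.OfV2 (F : T3Family) (𝔠 : AlphaConsts F.L (suGroupModel 2).N) : Prop :=
  ∃ a₀ a₁ : ℝ, 0 < a₀ ∧ 0 < a₁ ∧ 𝔠.B₃ * a₁ ≤ a₀ ∧
  ∀ (γ : ℝ) (hγ : 0 < γ) (hγ1 : γ ≤ (min 𝔠.gamma0 1) ^ 2) (K : ℕ),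
    ∃ (reg : ℕ → Set (GaugeField (F.P K) 0 (Matrix.specialUnitaryGroup (Fin 2) ℂ)))
      (Uk : (k : ℕ) → GaugeField (F.P K) (k + 1) (Matrix.specialUnitaryGroup (Fin 2) ℂ) →
        GaugeField (F.P K) 0 (Matrix.specialUnitaryGroup (Fin 2) ℂ))
      (UkH : (k : ℕ) → Hist (F.P K) k → GaugeField (F.P K) k (Matrix.specialUnitaryGroup (Fin 2) ℂ) →
        GaugeField (F.P K) 0 (Matrix.specialUnitaryGroup (Fin 2) ℂ))
      (hU0 : ∀ V : GaugeField (F.P K) 0 (Matrix.specialUnitaryGroup (Fin 2) ℂ), UkH 0 (Hist.triv (F.P K) 0) V = V)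
      (hUs : ∀ (k : ℕ) (V : GaugeField (F.P K) (k + 1) (Matrix.specialUnitaryGroup (Fin 2) ℂ)),
        UkH (k + 1) (Hist.triv (F.P K) (k + 1)) V = Uk k V)
      (𝔖 : ∀ k, StepSeries (T3Scales F γ hγ (hγ1.trans (sq_min_one_le _ 𝔠.gamma0_pos)) K)
        (Matrix.specialUnitaryGroup (Fin 2) ℂ) ↥(lieC (suGroupModel 2))
        (nblkOf (T3Scales F γ hγ (hγ1.trans (sq_min_one_le _ 𝔠.gamma0_pos)) K) 𝔠.lane.carrier k) k)
      (𝔄 : AlphaDataAC (suGroupModel 2) 𝔠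
        (XT3 F γ hγ (hγ1.trans (sq_min_one_le _ 𝔠.gamma0_pos)) K reg Uk UkH hU0 hUs) 𝔖),
      RunAlphaAC (suGroupModel 2) 𝔠 (XT3 F γ hγ (hγ1.trans (sq_min_one_le _ 𝔠.gamma0_pos)) K reg Uk UkH hU0 hUs) 𝔖 𝔄 ∧
        MinimiserRowsT3 F 𝔠 γ hγ hγ1 a₀ a₁ K UkH ∧
          TerminalRowsT3 F 𝔠 γ hγ hγ1 K (XT3 F γ hγ (hγ1.trans (sq_min_one_le _ 𝔠.gamma0_pos)) K reg Uk UkH hU0 hUs) 𝔖 (𝔄.cP K)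

/-- **`AlphaInputsT3ACv2 L`** — the version-2 (α) input package READ AT THE T³ OBJECTS for block size `L`: ONE primitive-constants record serves
every three-torus family of block size `L` (as v1's `AlphaInputsT3AC L`, with `OfV2`).  The closed proposition a route item can name; OPEN,
never asserted. [cite: Balaban1985UV3, Thm 1 p.257 + Thm 2 p.272; Balaban1985Variational, Thm 1 (8) p.279] -/
def AlphaInputsT3ACv2 (L : ℕ) : Prop :=
  ∃ 𝔠 : AlphaConsts L (suGroupModel 2).N, ∀ (F : T3Family) (hF : F.L = L), AlphaInputsT3AC.OfV2 F (hF ▸ 𝔠)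

/-- The alias of the version-2 socket in the owner's `AtScale` vocabulary. [cite: Balaban1985UV3, Thm 2 p.272] -/
abbrev AtScaleT3ACv2 (L : ℕ) : Prop := AlphaInputsT3ACv2 L

/-- Unfolding lemma. -/
theorem alphaInputsT3ACv2_iff (L : ℕ) :
    AlphaInputsT3ACv2 L ↔ ∃ 𝔠 : AlphaConsts L (suGroupModel 2).N, ∀ (F : T3Family) (hF : F.L = L), AlphaInputsT3AC.OfV2 F (hF ▸ 𝔠) :=
  Iff.rfl

/-- **v2 ⇒ v1 per family**: dropping the minimiser and terminal rows gives v1's `AlphaInputsT3AC.Of F 𝔠` — so every landed consequence of v1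
(`Thm2AC` feed, Bridge, Data, Histories, TrivRows, Envelope) applies to a v2 package BY NAME. [cite: Balaban1985UV3, Thm 2 p.272] -/
theorem AlphaInputsT3AC.OfV2.toOf {F : T3Family} {𝔠 : AlphaConsts F.L (suGroupModel 2).N} (h : AlphaInputsT3AC.OfV2 F 𝔠) :
    AlphaInputsT3AC.Of F 𝔠 := by
  obtain ⟨_, _, -, -, -, hall⟩ := h
  intro γ hγ hγ1 K
  obtain ⟨reg, Uk, UkH, hU0, hUs, 𝔖, 𝔄, hR, -, -⟩ := hall γ hγ hγ1 K
  exact ⟨reg, Uk, UkH, hU0, hUs, 𝔖, 𝔄, hR⟩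

/-- **v2 ⇒ v1 at a block size.** [cite: Balaban1985UV3, Thm 2 p.272] -/
theorem AlphaInputsT3ACv2.toV1 {L : ℕ} (h : AlphaInputsT3ACv2 L) : AlphaInputsT3AC L := by
  obtain ⟨𝔠, h𝔠⟩ := h
  refine ⟨𝔠, fun F hF => ?_⟩
  have h2 := h𝔠 F hF
  subst hF
  exact h2.toOf

/-- Instantiation at a family of the given block size (the cast disappears). -/
theorem AlphaInputsT3ACv2.of_family {F : T3Family} (h : AlphaInputsT3ACv2 F.L) :
    ∃ 𝔠 : AlphaConsts F.L (suGroupModel 2).N, AlphaInputsT3AC.OfV2 F 𝔠 := by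
  obtain ⟨𝔠, h𝔠⟩ := h
  exact ⟨𝔠, h𝔠 F rfl⟩

/-! ## §3 The package's data at one `(γ, K)` as a record carrying the rows and the constants -/

section Pkg

variable (F : T3Family) (𝔠 : AlphaConsts F.L (suGroupModel 2).N) (γ : ℝ) (hγ : 0 < γ) (hγ1 : γ ≤ (min 𝔠.gamma0 1) ^ 2) (K : ℕ)

/-- **THE VERSION-2 PACKAGE'S DATA AT `(γ, K)`**: v1's record `AlphaInputsT3AC.PkgAt` (data + AC (α) rows) EXTENDED by the package's [7] constants
`a₀, a₁` (with `0 < a₀`, `0 < a₁`, `B₃a₁ ≤ a₀`), the minimiser rows `MinimiserRowsT3 … a₀ a₁ K UkH` and the terminal rows `TerminalRowsT3`; through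
`toPkgAt` every v1 `PkgAt` theorem applies. [cite: Balaban1985UV3, Thm 2 p.272; Balaban1985Variational, Thm 1 (8) p.279] -/
structure AlphaInputsT3AC.PkgAtV2 extends AlphaInputsT3AC.PkgAt F 𝔠 γ hγ hγ1 K where
  /-- the constant `a₀` of [Balaban1985Variational] Thm 1 (upper radius of the space (6)) -/
  a₀ : ℝ
  /-- the constant `a₁` of [Balaban1985Variational] Thm 1 (data smallness (7)) -/
  a₁ : ℝ
  /-- `0 < a₀`, `0 < a₁`, `B₃a₁ ≤ a₀` -/
  consts_ok : 0 < a₀ ∧ 0 < a₁ ∧ 𝔠.B₃ * a₁ ≤ a₀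
  /-- the minimiser rows r1–r3 for `UkH` -/
  minRows : MinimiserRowsT3 F 𝔠 γ hγ hγ1 a₀ a₁ K UkH
  /-- the terminal data-regularity rows at `k = K` -/
  termRows : TerminalRowsT3 F 𝔠 γ hγ hγ1 K (XT3 F γ hγ (hγ1.trans (sq_min_one_le _ 𝔠.gamma0_pos)) K reg Uk UkH hU0 hUs) 𝔖 (𝔄.cP K)

variable {F 𝔠 γ hγ hγ1 K}

/-- The package's constant `a₀` of [Balaban1985Variational] Thm 1 (chosen once per `(F, 𝔠)`; uniform in `γ`, `K`). [cite: Balaban1985Variational, Thm 1 (8) p.279] -/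
noncomputable def AlphaInputsT3AC.OfV2.a₀ (h : AlphaInputsT3AC.OfV2 F 𝔠) : ℝ := h.choose

/-- The package's constant `a₁` of [Balaban1985Variational] Thm 1. [cite: Balaban1985Variational, Thm 1 (7)-(8) p.279] -/
noncomputable def AlphaInputsT3AC.OfV2.a₁ (h : AlphaInputsT3AC.OfV2 F 𝔠) : ℝ := h.choose_spec.choose

/-- The package unfolded at its chosen constants. [cite: Balaban1985UV3, Thm 2 p.272; Balaban1985Variational, Thm 1 (8) p.279] -/
theorem AlphaInputsT3AC.OfV2.consts_spec (h : AlphaInputsT3AC.OfV2 F 𝔠) :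
    0 < h.a₀ ∧ 0 < h.a₁ ∧ 𝔠.B₃ * h.a₁ ≤ h.a₀ ∧
    ∀ (γ : ℝ) (hγ : 0 < γ) (hγ1 : γ ≤ (min 𝔠.gamma0 1) ^ 2) (K : ℕ),
    ∃ (reg : ℕ → Set (GaugeField (F.P K) 0 (Matrix.specialUnitaryGroup (Fin 2) ℂ)))
      (Uk : (k : ℕ) → GaugeField (F.P K) (k + 1) (Matrix.specialUnitaryGroup (Fin 2) ℂ) →
        GaugeField (F.P K) 0 (Matrix.specialUnitaryGroup (Fin 2) ℂ))
      (UkH : (k : ℕ) → Hist (F.P K) k → GaugeField (F.P K) k (Matrix.specialUnitaryGroup (Fin 2) ℂ) →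
        GaugeField (F.P K) 0 (Matrix.specialUnitaryGroup (Fin 2) ℂ))
      (hU0 : ∀ V : GaugeField (F.P K) 0 (Matrix.specialUnitaryGroup (Fin 2) ℂ), UkH 0 (Hist.triv (F.P K) 0) V = V)
      (hUs : ∀ (k : ℕ) (V : GaugeField (F.P K) (k + 1) (Matrix.specialUnitaryGroup (Fin 2) ℂ)),
        UkH (k + 1) (Hist.triv (F.P K) (k + 1)) V = Uk k V)
      (𝔖 : ∀ k, StepSeries (T3Scales F γ hγ (hγ1.trans (sq_min_one_le _ 𝔠.gamma0_pos)) K)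
        (Matrix.specialUnitaryGroup (Fin 2) ℂ) ↥(lieC (suGroupModel 2))
        (nblkOf (T3Scales F γ hγ (hγ1.trans (sq_min_one_le _ 𝔠.gamma0_pos)) K) 𝔠.lane.carrier k) k)
      (𝔄 : AlphaDataAC (suGroupModel 2) 𝔠
        (XT3 F γ hγ (hγ1.trans (sq_min_one_le _ 𝔠.gamma0_pos)) K reg Uk UkH hU0 hUs) 𝔖),
      RunAlphaAC (suGroupModel 2) 𝔠 (XT3 F γ hγ (hγ1.trans (sq_min_one_le _ 𝔠.gamma0_pos)) K reg Uk UkH hU0 hUs) 𝔖 𝔄 ∧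
        MinimiserRowsT3 F 𝔠 γ hγ hγ1 h.a₀ h.a₁ K UkH ∧
          TerminalRowsT3 F 𝔠 γ hγ hγ1 K (XT3 F γ hγ (hγ1.trans (sq_min_one_le _ 𝔠.gamma0_pos)) K reg Uk UkH hU0 hUs) 𝔖 (𝔄.cP K) :=
  h.choose_spec.choose_spec

/-- The version-2 package at `(γ, K)` is inhabited by a record CARRYING THE PACKAGE'S CONSTANTS. [cite: Balaban1985UV3, Thm 2 p.272] -/
theorem AlphaInputsT3AC.OfV2.nonempty_pkgAtV2_consts (h : AlphaInputsT3AC.OfV2 F 𝔠) (γ : ℝ) (hγ : 0 < γ) (hγ1 : γ ≤ (min 𝔠.gamma0 1) ^ 2)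
    (K : ℕ) : Nonempty {p : AlphaInputsT3AC.PkgAtV2 F 𝔠 γ hγ hγ1 K // p.a₀ = h.a₀ ∧ p.a₁ = h.a₁} := by
  obtain ⟨h0, h1, hw, hall⟩ := h.consts_spec
  obtain ⟨reg, Uk, UkH, hU0, hUs, 𝔖, 𝔄, hR, hM, hT⟩ := hall γ hγ hγ1 K
  exact ⟨⟨⟨⟨reg, Uk, UkH, hU0, hUs, 𝔖, 𝔄, hR⟩, h.a₀, h.a₁, ⟨h0, h1, hw⟩, hM, hT⟩, rfl, rfl⟩⟩

/-- **THE VERSION-2 PACKAGE'S DATA, CHOSEN** (classical choice through `nonempty_pkgAtV2_consts`, so that the constants are the package's).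
[cite: Balaban1985UV3, Thm 2 p.272] -/
noncomputable def AlphaInputsT3AC.OfV2.pkgAtV2 (h : AlphaInputsT3AC.OfV2 F 𝔠) (γ : ℝ) (hγ : 0 < γ) (hγ1 : γ ≤ (min 𝔠.gamma0 1) ^ 2)
    (K : ℕ) : AlphaInputsT3AC.PkgAtV2 F 𝔠 γ hγ hγ1 K :=
  (Classical.choice (h.nonempty_pkgAtV2_consts γ hγ hγ1 K)).1

/-- The chosen package's `a₀` IS the package's `a₀` — the same at every `(γ, K)`. [cite: Balaban1985Variational, Thm 1 (8) p.279] -/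
theorem AlphaInputsT3AC.OfV2.pkgAtV2_a₀ (h : AlphaInputsT3AC.OfV2 F 𝔠) (γ : ℝ) (hγ : 0 < γ) (hγ1 : γ ≤ (min 𝔠.gamma0 1) ^ 2) (K : ℕ) :
    (h.pkgAtV2 γ hγ hγ1 K).a₀ = h.a₀ :=
  (Classical.choice (h.nonempty_pkgAtV2_consts γ hγ hγ1 K)).2.1

/-- The chosen package's `a₁` IS the package's `a₁`. [cite: Balaban1985Variational, Thm 1 (7)-(8) p.279] -/
theorem AlphaInputsT3AC.OfV2.pkgAtV2_a₁ (h : AlphaInputsT3AC.OfV2 F 𝔠) (γ : ℝ) (hγ : 0 < γ) (hγ1 : γ ≤ (min 𝔠.gamma0 1) ^ 2) (K : ℕ) :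
    (h.pkgAtV2 γ hγ hγ1 K).a₁ = h.a₁ :=
  (Classical.choice (h.nonempty_pkgAtV2_consts γ hγ hγ1 K)).2.2

end Pkg

/-! ## §4 The rows projected from the record -/

section Rows2

variable {F : T3Family} {𝔠 : AlphaConsts F.L (suGroupModel 2).N} {γ : ℝ} {hγ : 0 < γ} {hγ1 : γ ≤ (min 𝔠.gamma0 1) ^ 2} {K : ℕ}
  (p : AlphaInputsT3AC.PkgAtV2 F 𝔠 γ hγ hγ1 K)

/-- r2 projected: (42)/(67) at the top level for a charged pair. [cite: Balaban1985UV3, (42) p.266 and (67) p.273] -/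
theorem AlphaInputsT3AC.PkgAtV2.constraint42 (k : ℕ) (hk : k ≤ K) (h : Hist (F.P K) k)
    (W : GaugeField (F.P K) k (Matrix.specialUnitaryGroup (Fin 2) ℂ))
    (hc : ChargedT3 F γ 𝔠.b₀ 𝔠.p₀ (avgWindowFactor F.L) K 𝔠.lane.carrier.M₁
      (rcolOf (T3Scales F γ hγ (hγ1.trans (sq_min_one_le _ 𝔠.gamma0_pos)) K) 𝔠.lane.carrier) k h W)
    (b : PBond (F.P K) k)
    (hb : b ∈ bondsIn k (Omega 𝔠.lane.carrier.M₁
      (rcolOf (T3Scales F γ hγ (hγ1.trans (sq_min_one_le _ 𝔠.gamma0_pos)) K) 𝔠.lane.carrier) k h k)) :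
    Averaging.iter (fun i => BlockAveraging.blockAvg (P := F.P K) (j := i) ℰp) k (p.UkH k h W) b = W b :=
  p.minRows.2.1 k hk h W hc b hb

/-- r3 projected: (68) in the multi-level form for a charged pair. [cite: Balaban1985UV3, (68) p.273] -/
theorem AlphaInputsT3AC.PkgAtV2.regularity68Levels (k : ℕ) (hk : k ≤ K) (h : Hist (F.P K) k)
    (W : GaugeField (F.P K) k (Matrix.specialUnitaryGroup (Fin 2) ℂ))
    (hc : ChargedT3 F γ 𝔠.b₀ 𝔠.p₀ (avgWindowFactor F.L) K 𝔠.lane.carrier.M₁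
      (rcolOf (T3Scales F γ hγ (hγ1.trans (sq_min_one_le _ 𝔠.gamma0_pos)) K) 𝔠.lane.carrier) k h W)
    (i : ℕ) (hi : i ≤ k) (s : ℕ) (hs : s ≤ i) (q : Plaq (F.P K) s)
    (hq : q ∈ plaqsIn s (lam42 (Omega 𝔠.lane.carrier.M₁
      (rcolOf (T3Scales F γ hγ (hγ1.trans (sq_min_one_le _ 𝔠.gamma0_pos)) K) 𝔠.lane.carrier) k h) k i)) :
    GaugeGroup.dist1 (GaugeField.plaqHol
        (Averaging.iter (fun l => BlockAveraging.blockAvg (P := F.P K) (j := l) ℰp) s (p.UkH k h W)) q) ≤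
      𝔠.C68 * θBal F.L γ 𝔠.b₀ 𝔠.p₀ (K - i) * (((F.L : ℝ) ^ (i - s))⁻¹) ^ 2 :=
  p.minRows.2.2 k hk h W hc i hi s hs q hq

/-- r1 projected, membership: for `n < K`, `0 < ε₁ ≤ a₁`, `B₃ε₁ ≤ ε₀ ≤ a₀` and an `ε₁`-small datum `V`, `U_{K−n}(triv, V)` lies in print's space
(6) at radius `ε₀` ((8) at `B₃ε₁`, then `regFibrePr_mono`). [cite: Balaban1985Variational, Thm 1 (8) p.279] -/
theorem AlphaInputsT3AC.PkgAtV2.uminTriv_mem_regFibrePr {n : ℕ} (hnK : n < K) {ε₁ ε₀ : ℝ} (hε₁ : 0 < ε₁) (ha₁ : ε₁ ≤ p.a₁)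
    (hlo : 𝔠.B₃ * ε₁ ≤ ε₀) (hhi : ε₀ ≤ p.a₀) (V : GaugeField (F.P n) 0 (Matrix.specialUnitaryGroup (Fin 2) ℂ)) (hV : PlaqSmall ε₁ V) :
    p.UkH (K - n) (Hist.triv (F.P K) (K - n))
        (fieldShift (F.sitesPerDir_eq (m := F.m) (K := K) (j := K - n) (m' := F.m) (K' := n) (j' := 0) (by omega)) V) ∈
      regFibrePr F n K hnK.le ε₀ V :=
  regFibrePr_mono F hlo V (p.minRows.1 n hnK ε₁ ε₀ hε₁ ha₁ hlo hhi V hV).1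

/-- r1 projected, value: under the same bookkeeping the Wilson action of `U_{K−n}(triv, V)` IS `minActionRegPr F n K _ ε₀ V`.
[cite: Balaban1985Variational, Thm 1 (8) p.279 and Prop 7 p.299] -/
theorem AlphaInputsT3AC.PkgAtV2.uminTriv_action_eq {n : ℕ} (hnK : n < K) {ε₁ ε₀ : ℝ} (hε₁ : 0 < ε₁) (ha₁ : ε₁ ≤ p.a₁)
    (hlo : 𝔠.B₃ * ε₁ ≤ ε₀) (hhi : ε₀ ≤ p.a₀) (V : GaugeField (F.P n) 0 (Matrix.specialUnitaryGroup (Fin 2) ℂ)) (hV : PlaqSmall ε₁ V) :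
    wilsonAction4 (p.UkH (K - n) (Hist.triv (F.P K) (K - n))
        (fieldShift (F.sitesPerDir_eq (m := F.m) (K := K) (j := K - n) (m' := F.m) (K' := n) (j' := 0) (by omega)) V)) =
      minActionRegPr F n K hnK.le ε₀ V :=
  minActionRegPr_eq_of_isMinOn F (p.uminTriv_mem_regFibrePr hnK hε₁ ha₁ hlo hhi V hV) (p.minRows.1 n hnK ε₁ ε₀ hε₁ ha₁ hlo hhi V hV).2

/-- Terminal row projected: `U_K(·, h)` is measurable. [cite: Balaban1985UV3, (42) p.266] -/
theorem AlphaInputsT3AC.PkgAtV2.terminal_measurable_UkH (h : Hist (F.P K) K) : Measurable (p.UkH K h) :=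
  p.termRows.1 h

/-- Terminal row projected: `Pint_K(h, ·)` is measurable. [cite: Balaban1985UV3, (43) p.266] -/
theorem AlphaInputsT3AC.PkgAtV2.terminal_measurable_Pint (h : Hist (F.P K) K) :
    Measurable ((inputOfAC 𝔠.lane p.X p.𝔖).Pint K h) :=
  p.termRows.2.1 h

/-- Terminal row projected: `Pint_K(h, U) ≤ cP_K`. [cite: Balaban1985UV3, (46) p.267] -/
theorem AlphaInputsT3AC.PkgAtV2.terminal_Pint_le (h : Hist (F.P K) K) (U : GaugeField (F.P K) K (Matrix.specialUnitaryGroup (Fin 2) ℂ)) :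
    (inputOfAC 𝔠.lane p.X p.𝔖).Pint K h U ≤ p.𝔄.cP K :=
  p.termRows.2.2 h U

end Rows2

end Summit.QuantumFields.YangMills.Theorems

end
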